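import Summits.BirchSwinnertonDyer.Rank1Residual.X2.ResidualLineCharacters
import Literature.NumberTheory.EllipticCurves.GreenbergVatsal2000.CharacterPAdicLFunctionExistence
import Literature.NumberTheory.EllipticCurves.GreenbergVatsal2000.CharacterInvariants
import Literature.NumberTheory.EllipticCurves.GreenbergVatsal2000.EisensteinCongruence
import Literature.NumberTheory.EllipticCurves.GreenbergVatsal2000.EisensteinCongruenceResidualGoodOrdinary
import Literature.NumberTheory.EllipticCurves.TateUniformisation
import Summits.BirchSwinnertonDyer.Rank1Residual.X2.IsogenyLineType
import Summits.BirchSwinnertonDyer.Rank1Residual.X2.IsogenyLineTypeGoodOrdinary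
import Summits.BirchSwinnertonDyer.Rank1Residual.X2.EulerFactorAlgebra
import HarnessLib

/-!
# Class X2 (odd multiplicative Eisenstein prime): Greenberg–Vatsal's Thm. (3.11) + (28) + p. 43
# assembly UNFOLDED — the reading-facts A196 (multiplicative) and p253710 (good ordinary) as kernel
# consequences of Thm. (3.11) cited ONCE for both reduction types and of curve-free character facts
# (cell `b2b-bsdres`, unit `b2b-bsdres-eisenstein-p2`, gen 21)

HONEST FRAMING (run/shared/lean/b2b/bsd-rank1-residual/, verbatim in every file): the goal of the
cell is to DELETE the COMBINATION-SHAPED residual classes of the Birch–Swinnerton-Dyer formula for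
ALL analytic-rank `≤ 1` elliptic curves over `ℚ` — "full BSD formula for every rank `≤ 1` curve in
class `C`" assembled STRICTLY from published theorems — so that the rank-`≤ 1` remainder becomes
exactly the CONSTRUCTION-SHAPED classes, which are TYPED (missing-input `Prop`s), NOT attempted.
This is not "finishing BSD". Research route; NO CLAIM BEYOND STATED CLASSES; nothing here changes a
label. Theorems only (no definition, no named fact, nothing asserted).

## What this file proves

The cell's kernel proof of GV Thm. (1.3) at a multiplicative prime (X2a) and in the printed good
ordinary setting used TWO reading-facts transcribing the ANALYTIC half of Greenberg–Vatsal's p. 43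
assembly — `GreenbergVatsal2000.nonPrimitive_unitContent_and_lambda_eq_residual_of_lineRamifiedEven`
(A196, multiplicative; the referee's flag `GV00-mult-asserted` travelled on its multiplicative
TRANSCRIPTION, R133/R135.5) and `…_goodOrd` (p253710). Each folds GV Thm. (3.11) (the Eisenstein
congruence), display (28) (`L(G,T) = L_{Σ₀}(C,T)·L_{Σ₀}(D,T)`), Ferrero–Washington, Mazur–Wiles and
Props. (2.6)/(2.8) into one sentence per reduction type. Gen 21 UNFOLDS them into four registered
Literature statements, none of which transcribes anything from one reduction type to the other:

* (F1) `GreenbergVatsal2000.thm311_hasUnitContent_iff_and_order_eq_of_lineRamifiedEven` — GV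
  Thm. (3.11) + (28), `χ = 1`, ONE statement under GV's own §3 standing hypothesis "`E` has either
  good ordinary or multiplicative reduction at `p`" (p. 32; the printed proof treats `p ∣ M`
  explicitly), the ONLY input in which the curve meets the analytic side;
* (F2)/(F3) `GreenbergVatsal2000.characterLFunction{C,D}_hasUnitContent_and_order_eq_card` — the
  CURVE-FREE character identities of pp. 41–42 / 29 (Ferrero–Washington: `μ = 0`; Mazur–Wiles +
  Props. (2.6)/(2.8): `p^{λ(L_{Σ₀}(C,T))} = #H¹(ℚ_Σ/ℚ_∞, Φ)`, `p^{λ(L_{Σ₀}(D,T))} = #U`);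
* (F0) `GreenbergVatsal2000.exists_characterLFunction` — Kubota–Leopoldt–Iwasawa existence of
  `L_{Σ₀}(C,T)`, `L_{Σ₀}(D,T) ∈ Λ` (GV (26)/(27), Lang Ch. 10);

and PROVES in the kernel everything that connects them to the curve:

* §1–§2: the character `Γ_ℚ → 𝔽_pˣ` of a Galois module of prime order; **Kronecker–Weber for
  `𝔽_pˣ`-valued characters** (port of the tree's `ℂˣ`-valued dictionary
  `DirichletCharacterOfGaloisCharacter`, over the PROVED `KroneckerWeber_holds`): such a character
  is `θ ∘ χ_N` for a PRIMITIVE Dirichlet character `θ` mod `N`; ramification read off the conductor;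
* §3: the characters `φ` of `Φ₀` and `ψ` of `E[p]/Φ₀` (GV p. 28) as primitive Dirichlet characters
  `φ` mod `m`, `ψ` mod `d`, acting on the transported line / its quotient and on `E[p]`;
* §4: `φ` EVEN (from `LineEven`, `χ_m(c) = −1`), `ψ` ODD (gen 16: `c` acts as `−1` on `E[p]/Φ₀`);
* §5: `p ∣ m` (`φ` RAMIFIED at `p`) and `p ∤ d` (`ψ` UNRAMIFIED at `p`) from the local line at one
  prime `𝔓 ∣ p` — the Tate line `C[p]` at `p ‖ N` (gens 9/13/18, Tate uniformisation A40/A41) or the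
  reduction line `C_p[p]` at good ordinary `p` (gens 9/19/20) — which EQUALS the ramified rational
  line `Φ₀` (tree `eq_of_not_lineUnramifiedAt`) and has an inertially trivial quotient; and the primes
  of `m` (other than `p`) and of `d` lie in `Σ₀` (Néron–Ogg–Shafarevich, tree
  `smul_geomTorsion_eq_of_mem_inertia`, + the conductor criterion);
* §6: **`hasUnitContent_and_pow_order_eq_card_of_facts`** (both reduction types at once) and the two
  derivations **`nonPrimitive_unitContent_and_lambda_eq_residual_of_lineRamifiedEven_of_facts`**
  (`A40 → A41 → F0 → F1 → F2 → F3 → A196`) and **`…_goodOrd_of_facts`** (`F0 → F1 → F2 → F3 → p253710`).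

Consequently A64/A63/`X2.TargetA` (gen 18 `GreenbergVatsalInputsOfFacts`) and A14 (gen 20
`GreenbergVatsalThm13GoodOrdinary`) are terms of registered facts in which GV Thm. (3.11) is cited
once, verbatim, for good-ordinary-or-multiplicative `p`, and every other analytic input is a statement
about a Dirichlet character in which no elliptic curve (hence no reduction type) occurs.

References: [GreenbergVatsal2000] §2 pp. 26–30, §3 p. 32, pp. 41–43 (Thm. (3.11), (26)–(28));
[LangCyclotomic1990] Ch. 4 §3, Ch. 10 §2; [Washington1997] Ch. 3; [SilvermanAEC2009] VII.4.1;
HOME/b2b-bsdres-eisenstein-p2/X2-GAP.md §26.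
-/

set_option autoImplicit false

noncomputable section

open scoped Classical

open NumberField IsDedekindDomain Field Rat.HeightOneSpectrum WeierstrassCurve
  Literature.NumberTheory.GaloisRepresentations Literature.NumberTheory.EllipticCurves
  Literature.NumberTheory.EllipticCurves.Rank1Residual
  Summit.BirchSwinnertonDyer.Rank1Residual.X2.ResidualDevissageModules
  Summit.BirchSwinnertonDyer.Rank1Residual.X2.ResidualDevissageLine
  Summit.BirchSwinnertonDyer.Rank1Residual.X2.PrimeOrderCharacters
  Summit.BirchSwinnertonDyer.Rank1Residual.X2.ResidualLineCharacters

namespace Summit.BirchSwinnertonDyer.Rank1Residual.X2.EisensteinCongruenceOfFacts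

/-! ## §6. The reading-facts A196 and p253710 from the unfolded facts -/

section Assembly

open GreenbergVatsal2000 PowerSeries CongruenceSubgroup Literature.NumberTheory.EllipticCurves.ModularForms
open scoped MatrixGroups ModularForm

/-- **GV's p. 43 assembly from the UNFOLDED facts, at an odd prime of good ordinary OR
multiplicative reduction.** From (F0) the existence of `L_{Σ₀}(C,T)`, `L_{Σ₀}(D,T)`, (F1) the
Eisenstein congruence Thm. (3.11)+(28) in its mod-`p` form, (F2)/(F3) the character identities
(Ferrero–Washington, Mazur–Wiles, Props. (2.6)/(2.8)), and the local line at `p` (`hline`: the Tate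
line at `p ‖ N` / the reduction line at good ordinary `p`), for `Φ₀` a rational line ramified at `p`
and even: `b·∏𝒫_ℓ` has unit content and `p^{ord_T(b∏𝒫 mod p)} = #H¹(ℚ_Σ/ℚ_∞, Φ) · #U`. The
characters `φ`, `ψ` of `Φ₀`, `E[p]/Φ₀` are produced in the kernel (Kronecker–Weber), with `φ` even
and ramified at `p`, `ψ` odd and unramified at `p`, conductors supported on `Σ₀ ∪ {p}`
(Néron–Ogg–Shafarevich). -/
theorem hasUnitContent_and_pow_order_eq_card_of_facts
    (hEx : exists_characterLFunction)
    (h311 : thm311_hasUnitContent_iff_and_order_eq_of_lineRamifiedEven)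
    (hC : characterLFunctionC_hasUnitContent_and_order_eq_card)
    (hD : characterLFunctionD_hasUnitContent_and_order_eq_card)
    (W : WeierstrassCurve ℚ) [W.IsGloballyMinimal] [W.IsElliptic] (p : ℕ) [Fact p.Prime]
    (κ : ZpExtension ℚ p) {N : ℕ} [NeZero N] (f : CuspForm (Gamma0 N) 2)
    (S₀ : Finset (HeightOneSpectrum (𝓞 ℚ)))
    (Φ₀ : AddSubgroup (W.geomTorsion (p : ℤ))) (hΦ : IsRationalLine W p Φ₀)
    (hp2 : p ≠ 2)
    (hred : (W.HasGoodReductionAtPrime p ∧ ¬ (p : ℤ) ∣ W.frobeniusTrace p) ∨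
      W.HasMultiplicativeReductionAtPrime p)
    (hline : ∃ (v : HeightOneSpectrum (𝓞 ℚ)), (p : 𝓞 ℚ) ∈ v.asIdeal ∧ ∃ 𝔓 ∈ v.primesAbove,
      ∃ L : AddSubgroup (geomTorsion W (p : ℤ)), Nat.card L = p ∧
        (∀ σ ∈ 𝔓.inertia (absoluteGaloisGroup ℚ), ∀ P : geomTorsion W (p : ℤ), σ • P - P ∈ L) ∧
        (∃ σ ∈ 𝔓.inertia (absoluteGaloisGroup ℚ), ∃ P ∈ L, σ • P ≠ P))
    (hκ : κ.IsCyclotomic) (hram : ¬ LineUnramifiedAt W p Φ₀) (heven : LineEven W p Φ₀)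
    (hf : IsNewformOf W f)
    (hS₀p : ∀ v ∈ S₀, ((p : ℕ) : 𝓞 ℚ) ∉ v.asIdeal)
    (hS : ∀ v : HeightOneSpectrum (𝓞 ℚ), v ∉ S₀ → ((p : ℕ) : 𝓞 ℚ) ∉ v.asIdeal →
      W.HasGoodReductionAt v)
    (ϖ : ℚ) (hϖ : (ϖ : ℝ) * W.realPeriodRat = plusPeriod f)
    (L : PowerSeries ℚ_[p])
    (hLg : W.HasGoodReductionAtPrime p → L = padicLFunction f (unitRoot W p : ℚ_[p]))
    (hLs : W.HasSplitMultiplicativeReductionAtPrime p → IsSplitMultPAdicLFunctionOf f p L)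
    (hLns : W.HasMultiplicativeReductionAtPrime p → ¬ W.HasSplitMultiplicativeReductionAtPrime p →
      IsMultPAdicLFunctionOf f p (-1) L)
    (b : IwasawaAlgebra p) (hb : iwasawaToPowerSeries p b = PowerSeries.C ((ϖ : ℚ) : ℚ_[p]) * L) :
    HasUnitContent (b * eulerFactorProduct W p S₀) ∧
      p ^ (PowerSeries.map (PadicInt.toZMod (p := p)) (b * eulerFactorProduct W p S₀)).order.toNat =
        Nat.card (unramifiedOutside κ.kerSubgroup (lineSub Φ₀ hΦ).Sub p
            (↑S₀ : Set (HeightOneSpectrum (𝓞 ℚ)))) *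
          Nat.card (unramifiedSelmer κ.kerSubgroup (lineSub Φ₀ hΦ).Quot p
            (↑S₀ : Set (HeightOneSpectrum (𝓞 ℚ)))) := by
  -- the characters of `Φ₀` and `E[p]/Φ₀` (Kronecker–Weber)
  obtain ⟨m, _, φ, hφprim, hφA, hφ0⟩ := exists_character_sub hΦ
  obtain ⟨d, _, ψ, hψprim, hψQ, hψ0⟩ := exists_character_quot hΦ
  have hφeven : φ.Even := even_of_lineEven hΦ heven hφA
  have hψodd : ψ.Odd := odd_of_lineEven hΦ hp2 heven hψQ
  have hpm : p ∣ m := dvd_level_of_not_lineUnramifiedAt hΦ hline hram hφ0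
  have hpd : ¬ p ∣ d := not_dvd_level_of_not_lineUnramifiedAt hΦ hline hram hψprim hψQ
  have hSm : ∀ ℓ : ℕ, ℓ.Prime → ℓ ∣ m → ℓ ≠ p → ∃ v ∈ S₀, ((ℓ : ℕ) : 𝓞 ℚ) ∈ v.asIdeal :=
    fun ℓ hℓ hℓm hℓp ↦ exists_mem_of_dvd_level_sub hΦ hS hφprim hφA hℓ hℓm hℓp
  have hSd : ∀ ℓ : ℕ, ℓ.Prime → ℓ ∣ d → ∃ v ∈ S₀, ((ℓ : ℕ) : 𝓞 ℚ) ∈ v.asIdeal :=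
    fun ℓ hℓ hℓd ↦ exists_mem_of_dvd_level_quot hΦ hS hψprim hpd hψQ hℓ hℓd
  -- (F0) the character `p`-adic `L`-functions
  obtain ⟨gC, hgC⟩ := hEx.1 p m φ S₀ hp2 hpm hφprim hφeven hS₀p
  obtain ⟨gD, hgD⟩ := hEx.2 p d ψ S₀ hp2 hpd hψprim hψodd hS₀p
  -- (F1) the Eisenstein congruence
  obtain ⟨hiff, hord⟩ := h311 W p f S₀ Φ₀ m φ d ψ hp2 hred hΦ hram heven hf hφprim hψprim hφ0 hψ0
    hS₀p hS ϖ hϖ L hLg hLs hLns b hb gC gD hgC hgD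
  -- (F2), (F3) the character identities
  obtain ⟨hCu, hCcard⟩ := hC p κ m φ S₀ (lineSub Φ₀ hΦ).Sub hp2 hpm hφprim hφeven hκ hS₀p hSm
    (natCard_sub_eq hΦ) hφA gC hgC
  obtain ⟨hDu, hDcard⟩ := hD p κ d ψ S₀ (lineSub Φ₀ hΦ).Quot hp2 hpd hψprim hψodd hκ hS₀p hSd
    (natCard_quot_eq hΦ) hψQ gD hgD
  -- combine
  have hCD : HasUnitContent (gC * gD) := (EulerFactorAlgebra.hasUnitContent_mul_iff gC gD).mpr ⟨hCu, hDu⟩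
  refine ⟨hiff.mpr hCD, ?_⟩
  have hCfin : (PowerSeries.map (PadicInt.toZMod (p := p)) gC).order ≠ ⊤ := by
    rw [Ne, PowerSeries.order_eq_top]; exact (hasUnitContent_iff_map_toZMod_ne_zero gC).mp hCu
  have hDfin : (PowerSeries.map (PadicInt.toZMod (p := p)) gD).order ≠ ⊤ := by
    rw [Ne, PowerSeries.order_eq_top]; exact (hasUnitContent_iff_map_toZMod_ne_zero gD).mp hDu
  rw [hord hCD, map_mul, PowerSeries.order_mul, ENat.toNat_add hCfin hDfin, pow_add, hCcard, hDcard]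

/-- **A196 = `GreenbergVatsal2000.nonPrimitive_unitContent_and_lambda_eq_residual_of_lineRamifiedEven`
(GV Thm. (3.11)+(28)+p. 43 at a MULTIPLICATIVE prime, the reading-fact on which the flag
`GV00-mult-asserted` travelled) DERIVED from the unfolded facts** — Thm. (3.11) cited once for good
ordinary OR multiplicative reduction (F1), the curve-free character identities (F2)/(F3), the
Kubota–Leopoldt existence (F0) — and the Tate uniformisation A40/A41 (for the Tate line `C[p] = Φ₀`
at `p ‖ N`, gens 9/13/18). -/
theorem nonPrimitive_unitContent_and_lambda_eq_residual_of_lineRamifiedEven_of_facts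
    (hT : Silverman1994_thmV53_tateUniformisation.{0})
    (hT' : Silverman1994_thmV53_corV54_tateUniformisation.{0})
    (hEx : exists_characterLFunction)
    (h311 : thm311_hasUnitContent_iff_and_order_eq_of_lineRamifiedEven)
    (hC : characterLFunctionC_hasUnitContent_and_order_eq_card)
    (hD : characterLFunctionD_hasUnitContent_and_order_eq_card) :
    nonPrimitive_unitContent_and_lambda_eq_residual_of_lineRamifiedEven := by
  intro W _ _ p _ κ N _ f S₀ Φ₀ hΦ hp2 hmult hκ hram heven hf hS₀p hS ϖ hϖ L hLs hLns b hb
  have hline := IsogenyLineType.exists_tateLine_adicCompletionPrime W p hT hT' hp2 hmult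
  exact hasUnitContent_and_pow_order_eq_card_of_facts hEx h311 hC hD W p κ f S₀ Φ₀ hΦ hp2
    (Or.inr hmult) hline hκ hram heven hf hS₀p hS ϖ hϖ L
    (fun hgood ↦ absurd hgood
      (WeierstrassCurve.HasMultiplicativeReduction.not_hasGoodReduction (R := ℤ_[p]) hmult))
    hLs (fun _ hns ↦ hLns hns) b hb

/-- **p253710 = `GreenbergVatsal2000.nonPrimitive_unitContent_and_lambda_eq_residual_of_lineRamifiedEven_goodOrd`
(the PRINTED good-ordinary case of GV Thm. (3.11)+(28)+p. 43) DERIVED from the same unfolded facts**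
(reduction line `C_p[p] = Φ₀`, gens 9/19/20; no Tate fact). -/
theorem nonPrimitive_unitContent_and_lambda_eq_residual_of_lineRamifiedEven_goodOrd_of_facts
    (hEx : exists_characterLFunction)
    (h311 : thm311_hasUnitContent_iff_and_order_eq_of_lineRamifiedEven)
    (hC : characterLFunctionC_hasUnitContent_and_order_eq_card)
    (hD : characterLFunctionD_hasUnitContent_and_order_eq_card) :
    nonPrimitive_unitContent_and_lambda_eq_residual_of_lineRamifiedEven_goodOrd := by
  intro W _ _ p _ κ N _ f S₀ Φ₀ hΦ hp2 hgood hord hκ hram heven hf hS₀p hS ϖ hϖ b hb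
  have hline := IsogenyLineTypeGoodOrdinary.exists_reductionLine_adicCompletionPrime W p hp2 hgood hord
  have hnm : ¬ W.HasMultiplicativeReductionAtPrime p := fun hmult ↦
    WeierstrassCurve.HasMultiplicativeReduction.not_hasGoodReduction (R := ℤ_[p]) hmult hgood
  exact hasUnitContent_and_pow_order_eq_card_of_facts hEx h311 hC hD W p κ f S₀ Φ₀ hΦ hp2
    (Or.inl ⟨hgood, hord⟩) hline hκ hram heven hf hS₀p hS ϖ hϖ
    (padicLFunction f (unitRoot W p : ℚ_[p])) (fun _ ↦ rfl)
    (fun hs ↦ absurd hs.hasMultiplicativeReductionAtPrime hnm) (fun hm _ ↦ absurd hm hnm) b hb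

end Assembly

end Summit.BirchSwinnertonDyer.Rank1Residual.X2.EisensteinCongruenceOfFacts

end
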